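import Mathlib
import Literature.NumberTheory.Transcendental.KZProduct
import Literature.NumberTheory.Transcendental.KZSemiCanonicalReductionProofs
import Literature.NumberTheory.Transcendental.KZDominatedFamilyRelations
import Literature.NumberTheory.Transcendental.SemialgebraicMapsProofs
import Summits.KontsevichZagierPeriods.KontsevichZagierPeriods.Theorems.SoloInformedPolyJacobian
import Summits.KontsevichZagierPeriods.KontsevichZagierPeriods.Theorems.SoloInformedKZStokesCells
import Summits.KontsevichZagierPeriods.KontsevichZagierPeriods.Theorems.SoloInformedPiDiscQuarters
import Summits.KontsevichZagierPeriods.KontsevichZagierPeriods.Theorems.SoloInformedDiscCancellation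
import HarnessLib
import HarnessLib.Audit

/-!
# SoloInformed — solids of revolution, Ib: the flattening `Λ(u, z) = (u², z)` of the profile

For a planar representation `K` of dimension `2` with compact domain (coordinates `(u, z)`):

* `soloInformedRadialRep K` = `[K, 2u]` and `soloInformedFlatRep K` = `[Λ K, 1]` with
  `Λ(u, z) = (u², z)` (`Λ K` is `ℚ`-semialgebraic by Tarski–Seidenberg);
* rule (2) of the Kontsevich–Zagier calculus for `Λ` (`|det Λ'| = 2u`, injective on `u ≥ 0`):
  `[K, 2u] − [Λ K, 1] ∈ relations` when `K ⊆ {u ≥ 0}`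
  (`soloInformed_radialRep_sub_flatRep_mem_relations`);
* `[Λ K, 1]` is again a volume representation — compact domain with non-empty interior,
  integrand `1` (`soloInformed_isVolumeRep_flatRep`) — so the volume ladder
  (`SoloInformedVolumeLadder`) applies to it.

Used by `SoloInformedPappus`: `[Rev K, 1] ∼ [D̄ × Λ K, 1]` (Pappus–Guldin in the calculus:
`vol(Rev K) = π · area(Λ K) = 2π ∫_K u du dz`).

Residency `solo-KontsevichZagierPeriods-informed` (PLAN.md, session s16).
References: M. Kontsevich, D. Zagier, *Periods* (2001), §1.2 (rule (2));
J. Bochnak, M. Coste, M.-F. Roy, *Real algebraic geometry* (1998), Prop. 2.2.7 (images).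
-/

noncomputable section

open MeasureTheory Set Filter
open scoped Topology

namespace Summit.KontsevichZagierPeriods.KontsevichZagierPeriods.Theorems

open Literature.NumberTheory.Transcendental Literature.NumberTheory.Transcendental.KZ
open Literature.ModelTheory.ExponentialFields (IsSemialgebraic isSemialgebraic_setOf_eval_le
  isSemialgebraic_setOf_eval_lt isSemialgebraic_setOf_eval_pos isSemialgebraic_setOf_eval_eq_zero)

/-! ### The flattening `Λ(u, z) = (u², z)` of the profile -/

/-- `[K, 2u]`: the profile region weighted by twice the distance to the axis. -/
def soloInformedRadialRep (K : IntegralRep 2) (hKc : IsCompact K.domain) : IntegralRep 2 where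
  domain := K.domain
  integrand y := 2 * y 0
  isSemialgebraic_domain := K.isSemialgebraic_domain
  isSemialgebraicFunOn_integrand := by
    have h := isSemialgebraicFunOn_aeval K.isSemialgebraic_domain
      (MvPolynomial.C 2 * MvPolynomial.X 0 : MvPolynomial (Fin 2) ℚ)
    simp only [map_mul, MvPolynomial.aeval_X, map_ofNat] at h
    exact h
  integrableOn := (continuous_const.mul (continuous_apply 0)).continuousOn.integrableOn_compact hKc

/-- Domain of `[K, 2u]`. -/
@[simp] theorem soloInformedRadialRep_domain (K : IntegralRep 2) (hKc : IsCompact K.domain) :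
    (soloInformedRadialRep K hKc).domain = K.domain := rfl

/-- Integrand of `[K, 2u]`. -/
@[simp] theorem soloInformedRadialRep_integrand (K : IntegralRep 2) (hKc : IsCompact K.domain) :
    (soloInformedRadialRep K hKc).integrand = fun y => 2 * y 0 := rfl

/-- The flattening map as polynomials: `(u², z)`. -/
def soloInformedFlattenPoly : Fin 2 → MvPolynomial (Fin 2) ℚ :=
  ![MvPolynomial.X 0 ^ 2, MvPolynomial.X 1]

/-- The flattening map `Λ(u, z) = (u², z)`. -/
def soloInformedFlatten : (Fin 2 → ℝ) → (Fin 2 → ℝ) := soloInformedPolyMap soloInformedFlattenPoly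

/-- First component of `Λ`. -/
@[simp] theorem soloInformedFlatten_apply_zero (u : Fin 2 → ℝ) :
    soloInformedFlatten u 0 = u 0 ^ 2 := by
  simp [soloInformedFlatten, soloInformedFlattenPoly]

/-- Second component of `Λ`. -/
@[simp] theorem soloInformedFlatten_apply_one (u : Fin 2 → ℝ) : soloInformedFlatten u 1 = u 1 := by
  simp [soloInformedFlatten, soloInformedFlattenPoly]

/-- `Λ` is continuous. -/
theorem soloInformed_continuous_flatten : Continuous soloInformedFlatten :=
  continuous_iff_continuousAt.2 fun u =>
    (soloInformed_hasFDerivAt_polyMap soloInformedFlattenPoly u).continuousAt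

/-- Jacobian determinant of `Λ`: `det Λ'(u, z) = 2u`. -/
theorem soloInformed_det_flatten (u : Fin 2 → ℝ) :
    (soloInformedJacCLM soloInformedFlattenPoly u).det = 2 * u 0 := by
  rw [soloInformed_det_jacCLM, Matrix.det_fin_two]
  simp [soloInformedJacMat_apply, soloInformedFlattenPoly]

/-- The flattened region `Λ(K)` is `ℚ`-semialgebraic (Tarski–Seidenberg). -/
theorem isSemialgebraic_soloInformedFlatten_image (K : IntegralRep 2) :
    IsSemialgebraic ℚ (soloInformedFlatten '' K.domain) :=
  IsSemialgebraicMapOn.isSemialgebraic_image_holds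
    (isSemialgebraicMapOn_aeval K.isSemialgebraic_domain soloInformedFlattenPoly) Subset.rfl
    K.isSemialgebraic_domain

/-- **The flattened profile** `[Λ K, 1]` (domain `Λ(K)`). -/
def soloInformedFlatRep (K : IntegralRep 2) (hKc : IsCompact K.domain) : IntegralRep 2 where
  domain := soloInformedFlatten '' K.domain
  integrand _ := 1
  isSemialgebraic_domain := isSemialgebraic_soloInformedFlatten_image K
  isSemialgebraicFunOn_integrand := by
    simpa using isSemialgebraicFunOn_ratCast (isSemialgebraic_soloInformedFlatten_image K) 1
  integrableOn := continuous_const.continuousOn.integrableOn_compact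
    (hKc.image soloInformed_continuous_flatten)

/-- Domain of the flattened profile. -/
@[simp] theorem soloInformedFlatRep_domain (K : IntegralRep 2) (hKc : IsCompact K.domain) :
    (soloInformedFlatRep K hKc).domain = soloInformedFlatten '' K.domain := rfl

/-- Integrand of the flattened profile. -/
@[simp] theorem soloInformedFlatRep_integrand (K : IntegralRep 2) (hKc : IsCompact K.domain) :
    (soloInformedFlatRep K hKc).integrand = fun _ => 1 := rfl

/-- **Rule (2) for the flattening**: `[K, 2u] − [Λ K, 1] ∈ relations` when `K ⊆ {u ≥ 0}`
(`Λ` is injective there, `|det Λ'| = 2u`). -/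
theorem soloInformed_radialRep_sub_flatRep_mem_relations (K : IntegralRep 2)
    (hKc : IsCompact K.domain) (hK0 : K.domain ⊆ {y | 0 ≤ y 0}) :
    of (soloInformedRadialRep K hKc) - of (soloInformedFlatRep K hKc) ∈ relations := by
  refine changeOfVariablesRel_subset_relations ⟨2, soloInformedRadialRep K hKc,
    soloInformedFlatRep K hKc, soloInformedFlatten, soloInformedJacCLM soloInformedFlattenPoly,
    isSemialgebraicMapOn_aeval K.isSemialgebraic_domain soloInformedFlattenPoly,
    fun u _ => (soloInformed_hasFDerivAt_polyMap soloInformedFlattenPoly u).hasFDerivWithinAt,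
    ?_, rfl, fun u hu => ?_, rfl⟩
  · intro u hu v hv huv
    have e0 : u 0 ^ 2 = v 0 ^ 2 := by
      simpa only [soloInformedFlatten_apply_zero] using congr_fun huv 0
    have e1 : u 1 = v 1 := by simpa only [soloInformedFlatten_apply_one] using congr_fun huv 1
    have h0 : u 0 = v 0 := (pow_left_inj₀ (hK0 hu) (hK0 hv) two_ne_zero).1 e0
    exact funext (Fin.forall_fin_two.2 ⟨h0, e1⟩)
  · have hu0 : 0 ≤ u 0 := hK0 hu
    show 2 * u 0 = 1 * |(soloInformedJacCLM soloInformedFlattenPoly u).det|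
    rw [soloInformed_det_flatten, abs_of_nonneg (by positivity), one_mul]

/-- **The flattened profile of a volume region in `{u ≥ 0}` is a volume representation**
(compact; integrand `1`; non-empty interior: `Λ` restricted to `{u > 0}` is an open embedding). -/
theorem soloInformed_isVolumeRep_flatRep (K : IntegralRep 2) (hKc : IsCompact K.domain)
    (hKi : (interior K.domain).Nonempty) (hK0 : K.domain ⊆ {y | 0 ≤ y 0}) :
    SoloInformedIsVolumeRep (soloInformedFlatRep K hKc) := by
  refine ⟨hKc.image soloInformed_continuous_flatten, ?_, fun _ _ => rfl⟩
  obtain ⟨p, hp⟩ := hKi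
  rw [mem_interior_iff_mem_nhds, Metric.mem_nhds_iff] at hp
  obtain ⟨ε, hε, hball⟩ := hp
  -- the point `(p₀ − ε/2, p₁)` lies in the ball, hence in `K ⊆ {u ≥ 0}`: so `p₀ > 0`
  have hq : (![p 0 - ε / 2, p 1] : Fin 2 → ℝ) ∈ Metric.ball p ε := by
    rw [Metric.mem_ball, dist_pi_lt_iff hε]
    intro b
    fin_cases b
    · simp [abs_of_pos hε, hε]
    · simp [hε]
  have hp0 : 0 < p 0 := by
    have h := hK0 (hball hq)
    simp only [mem_setOf_eq, Matrix.cons_val_zero] at h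
    linarith
  -- `G(y) = (√y₀, y₁)` inverts `Λ` on `{u > 0}`
  set G : (Fin 2 → ℝ) → (Fin 2 → ℝ) := fun y => ![Real.sqrt (y 0), y 1] with hGdef
  have hGc : Continuous G := by
    refine continuous_pi fun j => ?_
    fin_cases j
    · simpa [hGdef] using (continuous_apply 0).sqrt
    · simpa [hGdef] using (continuous_apply 1)
  have hGp : G (soloInformedFlatten p) = p := by
    ext j
    fin_cases j
    · simp [hGdef, Real.sqrt_sq hp0.le]
    · simp [hGdef]
  refine ⟨soloInformedFlatten p, ?_⟩
  rw [mem_interior_iff_mem_nhds]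
  have h1 : G ⁻¹' Metric.ball p ε ∈ 𝓝 (soloInformedFlatten p) :=
    hGc.continuousAt.preimage_mem_nhds (by rw [hGp]; exact Metric.ball_mem_nhds p hε)
  have h2 : {y : Fin 2 → ℝ | 0 < y 0} ∈ 𝓝 (soloInformedFlatten p) :=
    (isOpen_lt continuous_const (continuous_apply 0)).mem_nhds (by
      simp only [mem_setOf_eq, soloInformedFlatten_apply_zero]; positivity)
  filter_upwards [h1, h2] with y hy1 hy2
  refine ⟨G y, hball hy1, ?_⟩
  ext j
  fin_cases j
  · simp [hGdef, Real.sq_sqrt (le_of_lt (by simpa using hy2))]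
  · simp [hGdef]

end Summit.KontsevichZagierPeriods.KontsevichZagierPeriods.Theorems
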